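import Summits.ResolutionOfSingularities.Statement
import Mathlib.RingTheory.Valuation.ValuationSubring
import Mathlib.RingTheory.RegularLocalRing.Defs
import Mathlib.RingTheory.Localization.AtPrime.Basic
import Mathlib.RingTheory.Localization.FractionRing
import Mathlib.FieldTheory.IntermediateField.Adjoin.Defs
import Mathlib.FieldTheory.Galois.Basic
import Mathlib.FieldTheory.PurelyInseparable.Basic
import Mathlib.RingTheory.Adjoin.FG

/-!
# ResolutionOfSingularities / CyclicCovers — assembly (corrected form) and thesis glue

Route `ResolutionOfSingularities/CyclicCovers` (local uniformization ascends along degree-`p`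
Galois / purely inseparable extensions, then Cossart–Piltant reduction, then Zariski patching).

* `stmt-ResolutionOfSingularities-0565` (assembly) as filed is `thesis → ResolutionOfSingularities`
  with thesis `= ∀ p prime, RelLU_p ∧ (LU_p → ResolutionInChar p)`; concluding needs `LU_p`, i.e.
  the reduction `RelLU_p → LU_p`, which is the separate open crux
  `stmt-ResolutionOfSingularities-0567` (Cossart–Piltant reduction in all dimensions). We prove
  the corrected assembly with that crux prepended: pure logic.
* The thesis `stmt-ResolutionOfSingularities-0564` is, per prime, the conjunction of the cruxes
  `stmt-ResolutionOfSingularities-0566` (`RelLU_p`) and `stmt-ResolutionOfSingularities-0561`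
  (`Patching_p`); recorded as glue.
-/

namespace Literature.AlgGeom

/-- Corrected assembly of route CyclicCovers (for `stmt-ResolutionOfSingularities-0565`): the
Cossart–Piltant reduction crux `RelLU_p → LU_p` (0567), the route thesis
`∀ p, RelLU_p ∧ (LU_p → ResolutionInChar p)` (0564) give the summit. Pure logic. [folklore] -/
theorem cyclicCovers_assembly_of_reduction :
    (∀ p : ℕ, p.Prime → (∀ (k K L : Type) [Field k] [CharP k p] [Field K] [Field L] [Algebra k K] [Algebra K L] [Algebra k L] [IsScalarTower k K L], (⊤ : IntermediateField k K).FG → Module.finrank K L = p → (IsGalois K L ∨ IsPurelyInseparable K L) → ∀ O : ValuationSubring L, (∀ c : k, algebraMap k L c ∈ O) → (∃ (A : Subalgebra k K) (h : A.toSubring ≤ (O.comap (algebraMap K L)).toSubring), A.FG ∧ IsFractionRing A K ∧ IsRegularLocalRing (Localization.AtPrime (Ideal.comap (Subring.inclusion h) (IsLocalRing.maximalIdeal (O.comap (algebraMap K L)))))) → ∃ (A : Subalgebra k L) (h : A.toSubring ≤ O.toSubring), A.FG ∧ IsFractionRing A L ∧ IsRegularLocalRing (Localization.AtPrime (Ideal.comap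 (Subring.inclusion h) (IsLocalRing.maximalIdeal O)))) → ∀ (k K : Type) [Field k] [CharP k p] [Field K] [Algebra k K], (⊤ : IntermediateField k K).FG → ∀ O : ValuationSubring K, (∀ c : k, algebraMap k K c ∈ O) → ∃ (A : Subalgebra k K) (h : A.toSubring ≤ O.toSubring), A.FG ∧ IsFractionRing A K ∧ IsRegularLocalRing (Localization.AtPrime (Ideal.comap (Subring.inclusion h) (IsLocalRing.maximalIdeal O)))) →
    (∀ p : ℕ, p.Prime → (∀ (k K L : Type) [Field k] [CharP k p] [Field K] [Field L] [Algebra k K] [Algebra K L] [Algebra k L] [IsScalarTower k K L], (⊤ : IntermediateField k K).FG → Module.finrank K L = p → (IsGalois K L ∨ IsPurelyInseparable K L) → ∀ O : ValuationSubring L, (∀ c : k, algebraMap k L c ∈ O) → (∃ (A : Subalgebra k K) (h : A.toSubring ≤ (O.comap (algebraMap K L)).toSubring), A.FG ∧ IsFractionRing A K ∧ IsRegularLocalRing (Localization.AtPrime (Ideal.comap (Subring.inclusion h) (IsLocalRing.maximalIdeal (O.comap (algebraMap K L)))))) → ∃ (A : Subalgebra k L) (h : A.toSubring ≤ O.toSubring),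 A.FG ∧ IsFractionRing A L ∧ IsRegularLocalRing (Localization.AtPrime (Ideal.comap (Subring.inclusion h) (IsLocalRing.maximalIdeal O)))) ∧ ((∀ (k K : Type) [Field k] [CharP k p] [Field K] [Algebra k K], (⊤ : IntermediateField k K).FG → ∀ O : ValuationSubring K, (∀ c : k, algebraMap k K c ∈ O) → ∃ (A : Subalgebra k K) (h : A.toSubring ≤ O.toSubring), A.FG ∧ IsFractionRing A K ∧ IsRegularLocalRing (Localization.AtPrime (Ideal.comap (Subring.inclusion h) (IsLocalRing.maximalIdeal O)))) → Literature.AlgebraicGeometry.Resolution.ResolutionInChar.{0} p)) → _root_.ResolutionOfSingularities := by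
  intro h67 h p hp
  obtain ⟨hRel, hPatch⟩ := h p hp
  exact hPatch (h67 p hp hRel)

/-- Glue for the thesis `stmt-ResolutionOfSingularities-0564`: it is, prime by prime, the
conjunction of `RelLU_p` (0566) and `Patching_p` (0561). [folklore] -/
theorem cyclicCovers_thesis_of_cruxes :
    (∀ p : ℕ, p.Prime → ∀ (k K L : Type) [Field k] [CharP k p] [Field K] [Field L] [Algebra k K] [Algebra K L] [Algebra k L] [IsScalarTower k K L], (⊤ : IntermediateField k K).FG → Module.finrank K L = p → (IsGalois K L ∨ IsPurelyInseparable K L) → ∀ O : ValuationSubring L, (∀ c : k, algebraMap k L c ∈ O) → (∃ (A : Subalgebra k K) (h : A.toSubring ≤ (O.comap (algebraMap K L)).toSubring), A.FG ∧ IsFractionRing A K ∧ IsRegularLocalRing (Localization.AtPrime (Ideal.comap (Subring.inclusion h) (IsLocalRing.maximalIdeal (O.comap (algebraMap K L)))))) → ∃ (A : Subalgebra k L) (h : A.toSubring ≤ O.toSubring), A.FG ∧ IsFractionRing A L ∧ IsRegularLocalRing (Localization.AtPrime (Ideal.comap (Subring.inclusion h) (IsLocalRing.maximalIdeal O)))) 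→
    (∀ p : ℕ, p.Prime → (∀ (k K : Type) [Field k] [CharP k p] [Field K] [Algebra k K], (⊤ : IntermediateField k K).FG → ∀ O : ValuationSubring K, (∀ c : k, algebraMap k K c ∈ O) → ∃ (A : Subalgebra k K) (h : A.toSubring ≤ O.toSubring), A.FG ∧ IsFractionRing A K ∧ IsRegularLocalRing (Localization.AtPrime (Ideal.comap (Subring.inclusion h) (IsLocalRing.maximalIdeal O)))) → Literature.AlgebraicGeometry.Resolution.ResolutionInChar.{0} p) →
    ∀ p : ℕ, p.Prime → (∀ (k K L : Type) [Field k] [CharP k p] [Field K] [Field L] [Algebra k K] [Algebra K L] [Algebra k L] [IsScalarTower k K L], (⊤ : IntermediateField k K).FG → Module.finrank K L = p → (IsGalois K L ∨ IsPurelyInseparable K L) → ∀ O : ValuationSubring L, (∀ c : k, algebraMap k L c ∈ O) → (∃ (A : Subalgebra k K) (h : A.toSubring ≤ (O.comap (algebraMap K L)).toSubring), A.FG ∧ IsFractionRing A K ∧ IsRegularLocalRing (Localization.AtPrime (Ideal.comap (Subring.inclusion h) (IsLocalRing.maximalIdeal (O.comap (algebraMap K L)))))) → ∃ (A : Subalgebra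 k L) (h : A.toSubring ≤ O.toSubring), A.FG ∧ IsFractionRing A L ∧ IsRegularLocalRing (Localization.AtPrime (Ideal.comap (Subring.inclusion h) (IsLocalRing.maximalIdeal O)))) ∧ ((∀ (k K : Type) [Field k] [CharP k p] [Field K] [Algebra k K], (⊤ : IntermediateField k K).FG → ∀ O : ValuationSubring K, (∀ c : k, algebraMap k K c ∈ O) → ∃ (A : Subalgebra k K) (h : A.toSubring ≤ O.toSubring), A.FG ∧ IsFractionRing A K ∧ IsRegularLocalRing (Localization.AtPrime (Ideal.comap (Subring.inclusion h) (IsLocalRing.maximalIdeal O)))) → Literature.AlgebraicGeometry.Resolution.ResolutionInChar.{0} p) :=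
  fun h1 h2 p hp => ⟨h1 p hp, h2 p hp⟩

end Literature.AlgGeom
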